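import Summits.BirchSwinnertonDyer.BirchSwinnertonDyer.Theorems.PrintCf2RamifiedOffTYZMoverSumBlocks
import Summits.BirchSwinnertonDyer.BirchSwinnertonDyer.Theorems.PrintCf2RamifiedOffTYZQFormIdentity
import Summits.BirchSwinnertonDyer.BirchSwinnertonDyer.Theorems.PrintCf2RamifiedOffTYZGaloisMotionDoor
import HarnessLib

/-!
# Crux `PrintCf2.RamifiedOffTYZOfFacts` (stmt-BirchSwinnertonDyer-20509), line `offtyz-v7`, LEAD cycle 8 (cruxlead-20509 g7):
# THE `s = 1` STRATUM OF THE RESIDUAL FOR `n ≡ 5 (mod 8)` — a Galois mover of the genus point EXISTS whenever `#Sel₂(E_n) = 8`, hence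
# (door p672160) `ord_{s=1} L(E_n,s) = rank E_n(ℚ) = 1`, `Ш(E_n)[2^∞] = 0` and `BSD(E_n, 2)`

THEOREMS ONLY (no `def`, no named fact, no `sorry`), `--supports stmt-BirchSwinnertonDyer-20509` (the `s = 1`, `n ≡ 5 (8)` stratum of item
23432 `RamifiedOffJumpOneOfFacts`; Smith 2016 Thm 1.4's missing quarter of `S(5)` — beyond print per the crux notes).

THE ASSEMBLY (`exists_sq_mover_of_card_selmer_eight`).  `n = p₁⋯p_k ≡ 5 (mod 8)` square-free.  By `…MoverSumBlocks`, for every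
automorphism `g` of `ℍ′_n`: `g*g` moves `P(n)` iff `Σ_{S adm} w_S·(1 + [g moves i] + Σ_{i∈S} xᵢ)·(ρ(N_S)·x) = 1`.  Evaluated at an
automorphism `g ∈ Gal(ℍ′_n/K_n)` with prime bits `x = eᵢ` (so `[g moves i] = 1`) the sum is `Ω_{ii}`, and with `x = eᵢ + e_j` (so `[g moves i] = 0`)
it is `Ω_{ij} + Ω_{ji}` (`Ω = QForm.Omega p`, g5); by g6's identity (★) `qFormIdentityOmega` these are `κB_i` resp. `(κA+κB)_i + (κA+κB)_j`
for Monsky's kernel vector `κ = QForm.kappa p`; `#Sel₂(E_n) = 8` makes `κ` THE Selmer class, and Monsky's non-degeneracy (p676494) gives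
`κB_i = 1` for some `i` or `κA_i ≠ κA_j` for some `i ≠ j` (with `κB = 0`); such bit vectors are realised by `…MoverCoordinates.exists_mem_galK_bits_eq`
(Gauss's count through the ring class dictionary).  So a mover `g*g` exists; it fixes `i` and every `√−d` (`…MoverSquares`), and the Galois-mover
door `GaloisMotion.rankOne_sha_bsdp_two_congruentNumberCurve_of_selmerEight_of_mover` (p672160) concludes.
HYPOTHESES (all printed statements, displayed or named in `Literature/…/TianYuanZhang2017`): the genus-point data `D` with `recursion`,
`thm35Main`, `scriptLSpec`, `lemma318` (`GenusPointData.Printed` conjuncts); the CM-point layer `CMBlockSpec`/`SevenBlockSpec`/`ConjSpec` and the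
ring class dictionary `RingClassTwoBlockSpec` on every block (`CMPointRingClassPrinted`, `tyz_cmPointRingClassData`); the FROBENIUS CLAUSE on
every block `d ≡ 5 (mod 8)` (for each prime `q ∣ d` an automorphism fixing `√−d`, squaring into `Gal(ℍ′_n/H′_d)`, acting on `i` and the `√−r`
(`r ∣ n` prime, `r ≠ q`) by Euler's criterion — the Artin symbol of the ramified prime `𝔭_q` in `H′_d = H_{d,𝒪₂}`; taken as an explicit
hypothesis `hFrob`, its display is filed separately); and Tian–Yuan–Zhang's Thm 1.1 (`thm11_parity_of_scriptL`).
BSD is not proved by any of this; no class is closed by this file (a conditional result toward item 23432).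

References: [cite: TianYuanZhang2017, Thm. 1.1, §3.1 (p0011 L1–L73), Prop. 3.2 (1), Thm. 3.5, Thm. 3.6 (1), Lemma 3.18, proof of Lemma 3.21
(p0020 L27–L63)]; [cite: HeathBrown1994SelmerCongruentII, Appendix (Monsky), typescript p. 39 L10–L41]; [cite: Smith2016CongruentDensity, Thm. 1.2,
Thm. 1.4]; [cite: Cox2013, §5.C Lemma 5.19, §7.D Thm. 7.24, §9.A]; [cite: Stevenhagen1995RedeiMatrices, §2 Thm. 1]; crux notes
`Lines/offtyz_v7_TransferLayer.md`, `Lines/offtyz_v7_QForm.md`, `Lines/offtyz_v7_QFormProof.md`.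
-/

noncomputable section

open scoped Classical NumberField

open WeierstrassCurve WeierstrassCurve.Affine Finset Matrix Literature.NumberTheory.EllipticCurves
  Literature.NumberTheory.EllipticCurves.TianYuanZhang2017
  Literature.NumberTheory.EllipticCurves.TianYuanZhang2017.W2
  Literature.NumberTheory.EllipticCurves.HeathBrown1994
  Literature.NumberTheory.EllipticCurves.Smith2016
  Literature.NumberTheory.QuadraticFields.RingClass
  Literature.NumberTheory.QuadraticFields
  Summit.BirchSwinnertonDyer.Rank1Residual.P2.GenusPeriodTransferLayer
  Summit.BirchSwinnertonDyer.PrintCf2.QForm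
  Summit.BirchSwinnertonDyer.PrintCf2.QFormForest

set_option autoImplicit false

namespace Summit.BirchSwinnertonDyer.PrintCf2.MoverAssembly

variable {k : ℕ} (p : Fin k → ℕ) (hp : ∀ i, (p i).Prime) (hodd : ∀ i, Odd (p i)) (hinj : Function.Injective p)
variable {n : ℕ} (D : GenusPointData n)

/-! ## §1 The block sum at the two test vectors -/

/-- `blockRho p S i = 0` off the block. [cite: HeathBrown1994SelmerCongruentII, Appendix (Monsky), typescript p. 39 L13–L26] -/
theorem blockRho_eq_zero_of_not_mem (S : Finset (Fin k)) {i : Fin k} (hi : i ∉ S) : blockRho p S i = 0 := by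
  rw [blockRho, dif_neg hi]

/-- **The block sum at `x = eᵢ`, `[g moves i] = 1`** equals `Ω_{ii}`. [cite: HeathBrown1994SelmerCongruentII, Appendix (Monsky), typescript p. 39 L27–L41] -/
theorem sum_blocks_single_eq_omega (i : Fin k) (xim : ZMod 2) (x : Fin k → ZMod 2) (hxim : xim = 1)
    (hx : ∀ l, x l = if l = i then 1 else 0) :
    (∑ S : Finset (Fin k), (if (∏ l ∈ S, p l) % 8 = 5 then
        coblockWeight p S * (1 + (xim + ∑ l ∈ S, x l)) * ∑ l ∈ S, blockRho p S l * x l else 0)) = Omega p i i := by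
  rw [Omega, Matrix.of_apply, Finset.sum_filter]
  refine Finset.sum_congr rfl fun S _ => ?_
  by_cases hS : (∏ l ∈ S, p l) % 8 = 5
  · rw [if_pos hS, if_pos ((admissible_eq_true_iff p S).mpr hS)]
    simp only [hx, hxim]
    rw [Finset.sum_ite_eq' S i (fun _ => (1 : ZMod 2))]
    have hsum : (∑ l ∈ S, blockRho p S l * if l = i then (1 : ZMod 2) else 0) = if i ∈ S then blockRho p S i else 0 := by
      rw [← Finset.sum_ite_eq' S i (fun l => blockRho p S l)]
      refine Finset.sum_congr rfl fun l _ => ?_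
      by_cases h : l = i
      · subst h; simp
      · rw [if_neg h, if_neg h, mul_zero]
    rw [hsum]
    by_cases hi : i ∈ S
    · simp only [hi, if_true]
      have : (1 : ZMod 2) + (1 + 1) = 1 := by decide
      rw [this]; ring
    · simp only [hi, if_false]; ring
  · rw [if_neg hS, if_neg (fun h => hS ((admissible_eq_true_iff p S).mp h))]

/-- **The block sum at `x = eᵢ + e_j` (`i ≠ j`), `[g moves i] = 0`** equals `Ω_{ij} + Ω_{ji}`. [cite: HeathBrown1994SelmerCongruentII, Appendix (Monsky), typescript p. 39 L27–L41] -/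
theorem sum_blocks_pair_eq_omega {i j : Fin k} (hij : i ≠ j) (xim : ZMod 2) (x : Fin k → ZMod 2) (hxim : xim = 0)
    (hx : ∀ l, x l = (if l = i then 1 else 0) + (if l = j then 1 else 0)) :
    (∑ S : Finset (Fin k), (if (∏ l ∈ S, p l) % 8 = 5 then
        coblockWeight p S * (1 + (xim + ∑ l ∈ S, x l)) * ∑ l ∈ S, blockRho p S l * x l else 0)) =
      Omega p i j + Omega p j i := by
  rw [Omega, Matrix.of_apply, Matrix.of_apply, Finset.sum_filter, Finset.sum_filter, ← Finset.sum_add_distrib]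
  refine Finset.sum_congr rfl fun S _ => ?_
  by_cases hS : (∏ l ∈ S, p l) % 8 = 5
  · have hS' : admissible p S = true := (admissible_eq_true_iff p S).mpr hS
    rw [if_pos hS, if_pos hS', if_pos hS']
    simp only [hx, hxim, zero_add, Finset.sum_add_distrib, mul_add]
    rw [Finset.sum_ite_eq' S i (fun _ => (1 : ZMod 2)), Finset.sum_ite_eq' S j (fun _ => (1 : ZMod 2))]
    have hsi : (∑ l ∈ S, blockRho p S l * if l = i then (1 : ZMod 2) else 0) = if i ∈ S then blockRho p S i else 0 := by
      rw [← Finset.sum_ite_eq' S i (fun l => blockRho p S l)]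
      refine Finset.sum_congr rfl fun l _ => ?_
      by_cases h : l = i
      · subst h; simp
      · rw [if_neg h, if_neg h, mul_zero]
    have hsj : (∑ l ∈ S, blockRho p S l * if l = j then (1 : ZMod 2) else 0) = if j ∈ S then blockRho p S j else 0 := by
      rw [← Finset.sum_ite_eq' S j (fun l => blockRho p S l)]
      refine Finset.sum_congr rfl fun l _ => ?_
      by_cases h : l = j
      · subst h; simp
      · rw [if_neg h, if_neg h, mul_zero]
    rw [hsi, hsj]
    have h2 : (2 : ZMod 2) = 0 := by decide
    by_cases hi : i ∈ S <;> by_cases hj : j ∈ S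
    · simp only [if_pos hi, if_pos hj]
      linear_combination (coblockWeight p S * blockRho p S i + coblockWeight p S * blockRho p S j) * h2
    · simp only [if_pos hi, if_neg hj, blockRho_eq_zero_of_not_mem p S hj]
      linear_combination (coblockWeight p S * blockRho p S i) * h2
    · simp only [if_neg hi, if_pos hj, blockRho_eq_zero_of_not_mem p S hi]
      linear_combination (coblockWeight p S * blockRho p S j) * h2
    · simp only [if_neg hi, if_neg hj, blockRho_eq_zero_of_not_mem p S hi, blockRho_eq_zero_of_not_mem p S hj]
      ring
  · have hS' : ¬ admissible p S = true := fun h => hS ((admissible_eq_true_iff p S).mp h)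
    rw [if_neg hS, if_neg hS', if_neg hS', add_zero]

/-! ## §2 Existence of the mover -/

include hp hodd hinj in
/-- **A SQUARE MOVER OF `P(n)` EXISTS WHEN `#Sel₂(E_n) = 8`** (`n = p₁⋯p_k ≡ 5 (mod 8)` square-free; hypotheses: the printed recursion and sign
choices of `𝓛`, the CM-point / ring-class displays on every block with ONE complex conjugation, the Frobenius clause on every block `d ≡ 5 (mod 8)`,
and TYZ Thm 1.1).  There is `g ∈ Gal(ℍ′_n/K_n)` with `g*g·P(n) ≠ P(n)`.
[cite: TianYuanZhang2017, §3.1 (p0011 L53–L73), Prop. 3.2 (1), Thm. 3.6 (1), proof of Lemma 3.21 (p0020 L27–L63), Thm. 1.1]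
[cite: HeathBrown1994SelmerCongruentII, Appendix (Monsky), typescript p. 39 L10–L41] [cite: Smith2016CongruentDensity, Thm. 1.4 ("the analytic rank one case")] -/
theorem exists_sq_mover_of_card_selmer_eight (hn : n = ∏ i, p i) (h5 : n % 8 = 5) (hrec : D.recursion) (hLs : D.scriptLSpec)
    (z : ℕ → APoint D.H) (Φ : ℕ → Finset (D.H ≃ₐ[ℚ] D.H)) (ΓH ΓH' : ℕ → Subgroup (D.H ≃ₐ[ℚ] D.H))
    (σ : ℕ → (D.H ≃ₐ[ℚ] D.H)) (c : D.H ≃ₐ[ℚ] D.H) (ρ : (d : ℕ) → (D.galK d →* RingClassGroup (GenusField d) 2))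
    (hc : D.ConjSpec c)
    (hblock : ∀ d ∈ n.divisors, ((d % 8 = 5 ∨ d % 8 = 6) → D.CMBlockSpec d (z d) (Φ d) (ΓH d) (ΓH' d) (σ d) c) ∧
      (d % 8 = 7 → D.SevenBlockSpec d))
    (hring : ∀ d ∈ n.divisors, d % 8 = 5 → D.RingClassTwoBlockSpec d (ΓH d) (ΓH' d) (ρ d))
    (hFrob : ∀ d ∈ n.divisors, d % 8 = 5 → ∀ q : ℕ, q.Prime → q ∣ d → ∃ φ : D.H ≃ₐ[ℚ] D.H,
      φ (D.sqrtNeg d) = D.sqrtNeg d ∧ φ * φ ∈ ΓH' d ∧ φ D.im = (jacobiSym (-1) q) • D.im ∧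
        ∀ r : ℕ, r.Prime → r ∣ n → r ≠ q → φ (D.sqrtNeg r) = (jacobiSym (-(r : ℤ)) q) • D.sqrtNeg r)
    (h11 : thm11_parity_of_scriptL)
    (hsel : Nat.card ((congruentNumberCurve n).selmerGroup 2) = 8) :
    ∃ g : D.H ≃ₐ[ℚ] D.H, g (D.sqrtNeg n) = D.sqrtNeg n ∧ D.galPt (g * g) (D.P n) ≠ D.P n := by
  have hsq : Squarefree n := by rw [hn]; exact squarefree_prod_of_injective p hp hinj
  have hn0 : n ≠ 0 := hsq.ne_zero
  have hnn : n ∈ n.divisors := Nat.mem_divisors_self n hn0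
  have hprod : ∏ i, p i = n := hn.symm
  have h5' : (∏ i, p i) % 8 = 5 := by rw [hprod]; exact h5
  have hsel' : Nat.card ((congruentNumberCurve (∏ i, p i)).selmerGroup 2) = 8 := by rw [hprod]; exact hsel
  have hblockn := (hblock n hnn).1 (Or.inl h5)
  have hringn := hring n hnn h5
  obtain ⟨hdiag, hoff⟩ := qFormIdentityOmega k p hp hodd hinj h5'
  -- the block-sum criterion for an arbitrary `g`
  have hcrit := fun g => sqMover_iff_sum_blocks p hp hodd hinj D hn h5 hrec hLs z Φ ΓH ΓH' σ c ρ hc hblock hring hFrob h11 g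
  -- the bit of `i` for `g ∈ Gal(ℍ′_n/K_n)` is the sum of the prime bits
  have him : ∀ g : D.H ≃ₐ[ℚ] D.H, g (D.sqrtNeg n) = D.sqrtNeg n →
      (if g D.im = D.im then (0 : ZMod 2) else 1) =
        ∑ l, (if g (D.im * D.sqrtNeg (p l)) = D.im * D.sqrtNeg (p l) then (0 : ZMod 2) else 1) := by
    intro g hg
    have h := bit_sqrtNeg_eq_bit_im_add_sum D p hnn hprod g
    rw [if_pos hg] at h
    have e : ∀ a b : ZMod 2, 0 = a + b → a = b := by decide
    exact e _ _ h
  by_cases hB : kappaB p = 0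
  · -- `κB = 0`, so `κA_i ≠ κA_j` for some `i ≠ j`: test vector `eᵢ + e_j`
    obtain ⟨i, j, hA⟩ : ∃ i j, kappaA p i ≠ kappaA p j :=
      (kappaB_ne_zero_or_kappaA_ne p hp hodd hinj h5' hsel').resolve_left (not_not.mpr hB)
    have hij : i ≠ j := fun h => hA (by rw [h])
    obtain ⟨g, hg, hbits⟩ := exists_mem_galK_bits_eq D p hp hodd hinj hsq hnn h5 hprod hblockn hringn
      (fun l => (if l = i then 1 else 0) + (if l = j then 1 else 0))
    refine ⟨g, hg, (hcrit g).mpr ?_⟩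
    rw [sum_blocks_pair_eq_omega p hij _ _ ?_ hbits, hoff i j hij]
    · have hB0 : ∀ l, kappaB p l = 0 := fun l => congr_fun hB l
      rw [hB0 i, hB0 j, add_zero, add_zero]
      rcases (by decide : ∀ x : ZMod 2, x = 0 ∨ x = 1) (kappaA p i) with h | h <;>
        rcases (by decide : ∀ x : ZMod 2, x = 0 ∨ x = 1) (kappaA p j) with h' | h'
      · exact absurd (h.trans h'.symm) hA
      · rw [h, h']; decide
      · rw [h, h']; decide
      · exact absurd (h.trans h'.symm) hA
    · rw [him g hg]
      simp only [hbits]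
      rw [Finset.sum_add_distrib, Finset.sum_ite_eq' univ i, if_pos (mem_univ i), Finset.sum_ite_eq' univ j, if_pos (mem_univ j)]
      decide
  · -- some `κB_i = 1`: test vector `eᵢ`
    obtain ⟨i, hi⟩ : ∃ i, kappaB p i ≠ 0 := by
      by_contra h; push Not at h; exact hB (funext h)
    have hi1 : kappaB p i = 1 := by
      rcases (by decide : ∀ x : ZMod 2, x = 0 ∨ x = 1) (kappaB p i) with h | h
      · exact absurd h hi
      · exact h
    obtain ⟨g, hg, hbits⟩ := exists_mem_galK_bits_eq D p hp hodd hinj hsq hnn h5 hprod hblockn hringn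
      (fun l => if l = i then 1 else 0)
    refine ⟨g, hg, (hcrit g).mpr ?_⟩
    rw [sum_blocks_single_eq_omega p i _ _ ?_ hbits, hdiag i, hi1]
    rw [him g hg]
    simp only [hbits]
    rw [Finset.sum_ite_eq' univ i, if_pos (mem_univ i)]

/-! ## §3 Through the Galois-mover door: `ord = rank = 1`, `Ш[2^∞] = 0`, `BSD(E_n, 2)` -/

include hp hodd hinj in
/-- **THE `s = 1` STRATUM FOR `n ≡ 5 (mod 8)`, THROUGH THE DOOR.**  For `n = p₁⋯p_k ≡ 5 (mod 8)` square-free with `#Sel⁽²⁾(E_n/ℚ) = 8`, granted the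
printed Tian–Yuan–Zhang §3 data on `n` (genus-point displays `recursion`, `thm35Main`, `scriptLSpec`, `lemma318`; the CM-point layer and the
conductor-`2` ring class dictionary on every block; the Frobenius clause on every block `d ≡ 5 (mod 8)`) and Thm 1.1:
`ord_{s=1} L(E_n, s) = 1`, `rank E_n(ℚ) = 1`, `Ш(E_n/ℚ)[2^∞] = 0`, and `BSD(E_n, 2)` holds.
[cite: TianYuanZhang2017, Thm. 1.1, §3.1, Prop. 3.2 (1), Thm. 3.5, Thm. 3.6 (1), Lemma 3.18, proof of Lemma 3.21]
[cite: HeathBrown1994SelmerCongruentII, Appendix (Monsky), typescript p. 39 L10–L41] [cite: Smith2016CongruentDensity, Thm. 1.4] [cite: Miller2011LMS, Def. 1.1] -/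
theorem rankOne_sha_bsdp_two_of_card_selmer_eight (hn : n = ∏ i, p i) (h5 : n % 8 = 5)
    (hrec : D.recursion) (h35 : D.thm35Main) (hLs : D.scriptLSpec) (h318 : D.lemma318)
    (z : ℕ → APoint D.H) (Φ : ℕ → Finset (D.H ≃ₐ[ℚ] D.H)) (ΓH ΓH' : ℕ → Subgroup (D.H ≃ₐ[ℚ] D.H))
    (σ : ℕ → (D.H ≃ₐ[ℚ] D.H)) (c : D.H ≃ₐ[ℚ] D.H) (ρ : (d : ℕ) → (D.galK d →* RingClassGroup (GenusField d) 2))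
    (hc : D.ConjSpec c)
    (hblock : ∀ d ∈ n.divisors, ((d % 8 = 5 ∨ d % 8 = 6) → D.CMBlockSpec d (z d) (Φ d) (ΓH d) (ΓH' d) (σ d) c) ∧
      (d % 8 = 7 → D.SevenBlockSpec d))
    (hring : ∀ d ∈ n.divisors, d % 8 = 5 → D.RingClassTwoBlockSpec d (ΓH d) (ΓH' d) (ρ d))
    (hFrob : ∀ d ∈ n.divisors, d % 8 = 5 → ∀ q : ℕ, q.Prime → q ∣ d → ∃ φ : D.H ≃ₐ[ℚ] D.H,
      φ (D.sqrtNeg d) = D.sqrtNeg d ∧ φ * φ ∈ ΓH' d ∧ φ D.im = (jacobiSym (-1) q) • D.im ∧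
        ∀ r : ℕ, r.Prime → r ∣ n → r ≠ q → φ (D.sqrtNeg r) = (jacobiSym (-(r : ℤ)) q) • D.sqrtNeg r)
    (h11 : thm11_parity_of_scriptL)
    (hsel : haveI := isElliptic_congruentNumberCurve (show n ≠ 0 by rw [hn]; exact (squarefree_prod_of_injective p hp hinj).ne_zero);
      Nat.card ((congruentNumberCurve n).selmerGroup 2) = 8) :
    haveI := isElliptic_congruentNumberCurve (show n ≠ 0 by rw [hn]; exact (squarefree_prod_of_injective p hp hinj).ne_zero)
    (congruentNumberCurve n).analyticRank = 1 ∧ (congruentNumberCurve n).mordellWeilRank = 1 ∧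
      AddCommGroup.primaryComponent (congruentNumberCurve n).sha 2 = ⊥ ∧
      BSDp (congruentNumberCurve n) 2 := by
  have hsq : Squarefree n := by rw [hn]; exact squarefree_prod_of_injective p hp hinj
  obtain ⟨g, -, hmove⟩ := exists_sq_mover_of_card_selmer_eight p hp hodd hinj D hn h5 hrec hLs z Φ ΓH ΓH' σ c ρ hc hblock hring
    hFrob h11 hsel
  exact GaloisMotion.rankOne_sha_bsdp_two_congruentNumberCurve_of_selmerEight_of_mover hsq (Or.inl h5) hsel D h35 hLs h318 (g * g)
    (mul_self_apply_im D g) (fun d hd => mul_self_apply_sqrtNeg D g hd) hmove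

end Summit.BirchSwinnertonDyer.PrintCf2.MoverAssembly

end
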